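import Literature.NumberTheory.Automorphic.UnitaryAdmissibleIrreducibleGlobalization     -- (n1) FILE A (A-p14 (g26)): `isIrreducibleGK_harishChandra_of_isAdmissibleGK`, `isInfUnitary_harishChandra`
import Summits.HodgeConjecture.HodgeConjecture.Theorems.F0P3UnitaryLocOfRecord            -- ★ `clInfChoiceU`, `clInfChoiceU_eq_ofModule`; cone: ★ `HasToken`, `Cinf`, `Gp`, `Cls`, `rep`, `IsCohUnitaryIrrep`
import Summits.HodgeConjecture.HodgeConjecture.Theorems.F0P3ArchTraceOfRealisation        -- ★ p838350 `isUnitary_of_descend`, `isStronglyContinuous_of_descend`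
import Summits.HodgeConjecture.HodgeConjecture.Theorems.F0P3bStubT3aUnitaryAlongPOfHermitian  -- ★ T3a₄ `stubT3aUnitaryAlongPOfHermitian_holds`
import Summits.HodgeConjecture.HodgeConjecture.Theorems.F0P3UFormExpGeneration            -- ★ `subgroup_eq_top_of_forall_expMem_mem_uForm`
import Literature.NumberTheory.Automorphic.HarishChandraModuleIntertwiners               -- ★ `Intertwiner.harishChandraMap`, `harishChandraMap_repK`, `harishChandraMap_repLie`
import Literature.NumberTheory.Automorphic.DiscreteSummandProjection                     -- ★ `ClosedSubrep.starProjection_map_apply`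
import Literature.NumberTheory.Automorphic.UnitaryGroupHolCotFormsArchCentre             -- ★ `cmArchSection_eq_archToAdelic_archPart`
import HarnessLib

/-!
# The CLASS of an admissible archimedean block of a discrete automorphic representation is the token of record — letter L-iso ⟸ F1a
# (ROAD «TF», J2, (n1)-junction «L-iso class half»; census A-p14 (g26) 2026-09-01, FILE B)

Cell `hodgecm-mathlib`, programme P3 «U3-mult», ROAD «TF».  The structure letter H3 of the closer's trace-factorisation block was split by ★ p839537
`F0P3ArchStructureLetterSplit.h3_of_core_of_adm_of_iso` into H3-core + L-adm + **L-iso**, where L-iso (its `hiso` binder) says: every closed topologically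
irreducible `G′_∞`-block `W ≤ rep c`, under any descent `σbar` along `archProjUForm`, is a unitary globalization of the archimedean class token of record
`clInfChoiceU … (rep c)` ([Dixmier1977 13.1.8] + [FlathCorvallis1979 Thms. 3–4] at the Hilbert-space level).

THIS FILE discharges L-iso from the letter F1a (★ `DiscreteAutomorphicRep.ArchIsotypy`, BY NAME) for every block whose Harish-Chandra module is
`K∞`-ADMISSIBLE (`IsAdmissibleGK (harishChandraRepK U(2,1) σbar)` — exactly the blocks to which ★ p839537 applies `hiso`: sub-blocks of a level-`K′` block made
admissible by L-adm):
* §1 `isTopIrreducible_of_descend` — topological irreducibility descends along `archProjUForm` (same lattice of closed invariant subspaces).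
* §2 `archLift : U(2,1) →* G′_∞` (continuous), `archToAdelic_archLift`, `archProjUForm_archLift` — the CM section lands in the archimedean factor:
  `cmArchSectionUForm u = archToAdelic (ℓ u)` with `archProjUForm (ℓ u) = u` (★ `cmArchSection_eq_archToAdelic_archPart`, ★ `archProjU21EmbCM_archPart_archSectionU21CM`).
* §3 **`hasToken_harishChandra_of_closedSubrep`** — the orthogonal projection `P.space → W` intertwines `P.archRepCM` with `σbar` (★ `ClosedSubrep.starProjection_map_apply`),
  so ★ `Intertwiner.harishChandraMap` is a `(𝔤, K)`-map `P.archModuleCM → H_K^∞(σbar)`, non-zero on the image of `H_K^∞(σbar) ≠ 0`: a TOKEN of `P` with target the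
  Harish-Chandra module of the block.
* §4 **`isUnitaryGlobalization_clInfChoiceU_of_archIsotypy`** — for `P` satisfying F1a at the CM frame, `W ≤ P.space` a closed topologically irreducible `G′_∞`-block with
  descent `σbar` and `K∞`-admissible Harish-Chandra module: `IsUnitaryGlobalization U(2,1) (clInfChoiceU L H ι T hT μ dflt P) σbar`.  PROOF: FILE A (Harish-Chandra
  irreducibility under admissibility, ★ `isIrreducibleGK_harishChandra_of_isAdmissibleGK`) makes `H_K^∞(σbar)` an irreducible admissible `(𝔤, K)`-module, infinitesimally
  unitary (★ `isInfUnitary_harishChandra`) hence COH-UNITARY (★ T3a₄ `stubT3aUnitaryAlongPOfHermitian_holds`); §3 makes it a token target of `P`; ★ `clInfChoiceU_eq_ofModule`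
  (F1a) pins `clInfChoiceU dflt P` to its class; and `σbar` is tautologically a unitary globalization of its own Harish-Chandra module.
  `liso_of_archIsotypy_of_isAdmissibleGK` — the same at `P := rep c`, i.e. THE `hiso` BINDER of ★ p839537 with two antecedents added (F1a by name; `K∞`-admissibility
  of the block) and `cptTriv₀ c` dropped (not needed once the descent is given).

THEOREMS + one `def` with body (`archLift`, a homomorphism `U(2,1) →* G′_∞`, §2); no instance, no notation, no named fact, no `sorry`.  NON-CLAIMS: L-iso VERBATIM (all blocks, no
admissibility) is NOT proved — it contains Harish-Chandra's admissibility theorem [HarishChandra1953 Thms. 4–6], in the tree only as the named fact ★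
`isAdmissibleGK_of_irreducible_unitary`; nothing is said about `hdef`.  HONEST LABEL: HC_CM is proved only modulo the 2 remaining named inputs (hLiu418, h413) until rung 0
closes; this file discharges no letter by itself (it turns L-iso♭ into F1a + ★).

## References
* Harish-Chandra, *Representations of a semisimple Lie group on a Banach space I*, Trans. AMS 75 (1953), §9 Thms. 4–6, Thm. 8 [HarishChandra1953].
* D. Flath, *Decomposition of representations into tensor products*, Corvallis 1979, part 1, Thm. 3 and Thm. 4 [FlathCorvallis1979].
* J. Dixmier, *C\*-algebras* (1977), §13.1.3, §13.1.8 [Dixmier1977].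
* A. Borel, N. Wallach, *Continuous cohomology, discrete subgroups, and representations of reductive groups* (2000), 0 §2.5 [BorelWallach2000].
* J. Rogawski, *Automorphic representations of unitary groups in three variables*, Ann. of Math. Stud. 123 (1990), §14.5 p. 237 [Rogawski1990].
-/

-- Mathlib idiom (as in ★ `GKModules`): commutator bracket, needed to MENTION `GKIrrClass (uFormGroup …)` ∕ `IsUnitaryGlobalization` ∕ `harishChandraRepLie`.
attribute [local instance 100] LieRing.ofAssociativeRing

set_option autoImplicit false
-- the mandated namespace repeats `HodgeConjecture.HodgeConjecture`, as in every `Theorems/*.lean` of this sub-problem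
set_option linter.dupNamespace false

noncomputable section

open MeasureTheory Measure NumberField Topology
open Literature.NumberTheory.Automorphic Literature.NumberTheory.Automorphic.UnitaryGroup
open Literature.NumberTheory.Automorphic.UnitaryGroup.CotangentForms
open Literature.RepresentationTheory Literature.RepresentationTheory.KonnoKonno2007 Literature.RepresentationTheory.KonnoKonno2007.RealDualPair
open Literature.RepresentationTheory.BorelWallach2000
open Literature.Geometry.ComplexHyperbolic.BallModel (U21)
open scoped Matrix InnerProductSpace

namespace Summit.HodgeConjecture.HodgeConjecture.Cruxes.H413.F0P3ArchBlockClassOfArchIsotypy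

open Summit.HodgeConjecture.HodgeConjecture.Cruxes.H413.F0P3InnerFormClassification (HasToken Cinf Gp)
open Summit.HodgeConjecture.HodgeConjecture.Cruxes.H413.F0P3ClassTokensOfRecord (Cls rep)
open Summit.HodgeConjecture.HodgeConjecture.Cruxes.H413.F0P3UnitaryLocOfRecord (clInfChoiceU clInfChoiceU_eq_ofModule)
open Summit.HodgeConjecture.HodgeConjecture.Cruxes.H413.F0P3bArchDegOnePackage (IsCohUnitaryIrrep IsUnitaryAlongP)
open Summit.HodgeConjecture.HodgeConjecture.Cruxes.H413.F0P3ArchTraceOfRealisation (isUnitary_of_descend isStronglyContinuous_of_descend)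
open Summit.HodgeConjecture.HodgeConjecture.Cruxes.H413.F0P3bStubT3aUnitaryAlongPOfHermitian (stubT3aUnitaryAlongPOfHermitian_holds)
open Summit.HodgeConjecture.HodgeConjecture.Cruxes.H413.F0P3UFormExpGeneration (subgroup_eq_top_of_forall_expMem_mem_uForm)
open ContRepresentation (ClosedSubrep)

variable (L : Type) [Field L] [NumberField L] [IsCMField L] (ι : L →+* ℂ) (H : Matrix (Fin 3) (Fin 3) L) (T : GL (Fin 3) ℂ)
  (hT : (T : Matrix (Fin 3) (Fin 3) ℂ)ᴴ * H.map ι * (T : Matrix (Fin 3) (Fin 3) ℂ) = Literature.Geometry.ComplexHyperbolic.BallModel.J)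

/-! ## §1 Topological irreducibility descends along `archProjUForm` -/

/-- **Irreducibility of a descent**: if `σ = σbar ∘ archProjUForm` (any representation `σ` of `G′_∞` factoring through `U(2,1)`) is topologically irreducible, so is
`σbar` — the closed `σbar`-invariant subspaces are closed `σ`-invariant subspaces and conversely (`archProjUForm` is onto, ★ `archProjUForm_surjective`).
[cite: Dixmier1977, §13.1.3] [cite: BorelJacquetCorvallis1979, §4.1] -/
theorem isTopIrreducible_of_descend {F : Type*} [NormedAddCommGroup F] [InnerProductSpace ℂ F]
    {σ : ContRepresentation ℂ (arch (↥(maximalRealSubfield L)) L (IsCMField.complexConj L) 3 H) F}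
    {σbar : ContRepresentation ℂ (uFormGroup (Fin 2) (Fin 1)).carrier F} (hσ : ∀ g, σ g = σbar (archProjUForm L ι H T hT g))
    (h : σ.IsTopIrreducible) : σbar.IsTopIrreducible := by
  let e : ClosedSubrep σ ≃o ClosedSubrep σbar :=
    { toFun := fun W =>
        { toSubmodule := W.toSubmodule
          apply_mem_toSubmodule := fun u v hv => by
            obtain ⟨g, rfl⟩ := archProjUForm_surjective L ι H T hT u
            have h1 := W.apply_mem g hv
            rw [hσ g] at h1
            exact h1
          isClosed' := W.isClosed }
      invFun := fun W =>
        { toSubmodule := W.toSubmodule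
          apply_mem_toSubmodule := fun g v hv => by
            have h1 := W.apply_mem (archProjUForm L ι H T hT g) hv
            rw [← hσ g] at h1
            exact h1
          isClosed' := W.isClosed }
      left_inv := fun W => by ext v; rfl
      right_inv := fun W => by ext v; rfl
      map_rel_iff' := fun {W W'} => Iff.rfl }
  exact e.isSimpleOrder_iff.1 h

/-! ## §2 The CM section lands in the archimedean factor -/

/-- **`archLift`** — the archimedean lift `U(2,1) →* G′_∞`: the archimedean part (★ `archPart`, a homomorphism) of the CM section ★ `cmArchSection` at the frame
preimage `u21FrameEquivFin1⁻¹ u`; a group homomorphism with `archToAdelic (archLift u) = cmArchSectionUForm u` and `archProjUForm (archLift u) = u` (below) — a SECTION of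
`archProjUForm` landing in the factor at `ι`. [cite: BorelJacquetCorvallis1979, §4.1] -/
def archLift : (uFormGroup (Fin 2) (Fin 1)).carrier →* arch (↥(maximalRealSubfield L)) L (IsCMField.complexConj L) 3 H :=
  (archPart (↥(maximalRealSubfield L)) L (IsCMField.complexConj L) 3 H).comp
    ((cmArchSection L ι H T hT).comp (u21FrameEquivFin1 : U21 ≃ₜ* UForm (Fin 2) (Fin 1)).symm.toMulEquiv.toMonoidHom)

/-- Unfolding `archLift`. [cite: BorelJacquetCorvallis1979, §4.1] -/
theorem archLift_apply (u : (uFormGroup (Fin 2) (Fin 1)).carrier) :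
    archLift L ι H T hT u =
      archPart (↥(maximalRealSubfield L)) L (IsCMField.complexConj L) 3 H (cmArchSection L ι H T hT (u21FrameEquivFin1.symm u)) := rfl

/-- `archLift` is continuous (★ `continuous_archPart`, ★ `continuous_archSectionU21CM`, the frame homeomorphism). [cite: BorelJacquetCorvallis1979, §4.1] -/
theorem continuous_archLift : Continuous (archLift L ι H T hT) :=
  (continuous_archPart (↥(maximalRealSubfield L)) L (IsCMField.complexConj L) 3 H).comp
    ((continuous_archSectionU21CM L ι H T hT).comp u21FrameEquivFin1.symm.continuous)

/-- `archToAdelic (archLift u) = cmArchSectionUForm u` (★ `cmArchSection_eq_archToAdelic_archPart`: the CM section is `(its archimedean part, 1)`).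
[cite: BorelJacquetCorvallis1979, §4.1] -/
theorem archToAdelic_archLift (u : (uFormGroup (Fin 2) (Fin 1)).carrier) :
    archToAdelic (↥(maximalRealSubfield L)) L (IsCMField.complexConj L) 3 H (archLift L ι H T hT u) = cmArchSectionUForm L ι H T hT u := by
  rw [cmArchSectionUForm_apply, archLift_apply]
  exact (cmArchSection_eq_archToAdelic_archPart L ι H T hT _).symm

/-- `archProjUForm (archLift u) = u` (★ `archProjU21EmbCM_archPart_archSectionU21CM`: the archimedean projection is a left inverse of the section, then the frame).
[cite: BorelJacquetCorvallis1979, §4.1] -/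
theorem archProjUForm_archLift (u : (uFormGroup (Fin 2) (Fin 1)).carrier) : archProjUForm L ι H T hT (archLift L ι H T hT u) = u := by
  rw [archProjUForm_apply, archLift_apply]
  change u21FrameEquivFin1 (archProjU21EmbCM L H ι T (formCongr_eq_of_conjTranspose L ι H T hT)
    (archPart (↥(maximalRealSubfield L)) L (IsCMField.complexConj L) 3 H (archSectionU21CM L ι H T hT (u21FrameEquivFin1.symm u)))) = u
  rw [archProjU21EmbCM_archPart_archSectionU21CM, ContinuousMulEquiv.apply_symm_apply]

/-! ## §3 The token: the orthogonal projection onto the block -/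

section Token

variable {L ι H T hT}
variable {μ : Measure (Gp L H).automorphicQuotient} [(Gp L H).IsAutomorphicMeasure μ]
  (P : DiscreteAutomorphicRep (Gp L H) μ)
  (W : ClosedSubrep (((Gp L H).rightRegular μ).restrict (archToAdelic (↥(maximalRealSubfield L)) L (IsCMField.complexConj L) 3 H)))
  (hW : W.toSubmodule ≤ P.space.toSubmodule)
  {σbar : ContRepresentation ℂ (uFormGroup (Fin 2) (Fin 1)).carrier W.toSubmodule}
  (hσ : ∀ g, W.toContRep g = σbar (archProjUForm L ι H T hT g))

include hσ in
/-- On the block, `σbar u` is the regular action of `cmArchSectionUForm u`: `↑(σbar u w) = R(cmArchSectionUForm u) ↑w` in `L²` (via `archLift`, §2).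
[cite: BorelJacquetCorvallis1979, §4.1 and §4.3] -/
theorem coe_descend_apply (u : (uFormGroup (Fin 2) (Fin 1)).carrier) (w : W.toSubmodule) :
    ((σbar u w : W.toSubmodule) : (Gp L H).L2 μ) = (Gp L H).rightRegular μ (cmArchSectionUForm L ι H T hT u) (w : (Gp L H).L2 μ) := by
  have h1 : σbar u = W.toContRep (archLift L ι H T hT u) := by rw [hσ, archProjUForm_archLift]
  rw [h1, ClosedSubrep.coe_toContRep_apply, ContRepresentation.restrict_apply, archToAdelic_archLift]

include hσ in
/-- **The orthogonal projection `P.space → W` intertwines `P.archRepCM` with `σbar`**: `p_W (R(s u) v) = σbar u (p_W v)` — `p_W` commutes with the unitary regular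
action of the archimedean element `archLift u` leaving `W` invariant (★ `ClosedSubrep.starProjection_map_apply`). [cite: Dixmier1977, §13.1.2] [cite: BorelJacquetCorvallis1979, §4.6] -/
theorem orthogonalProjection_intertwines (u : (uFormGroup (Fin 2) (Fin 1)).carrier) (v : P.space.toSubmodule) :
    (W.toSubmodule.orthogonalProjectionOnto.comp P.space.toSubmodule.subtypeL) (P.archRepCM ι T hT u v) =
      σbar u ((W.toSubmodule.orthogonalProjectionOnto.comp P.space.toSubmodule.subtypeL) v) := by
  apply Subtype.ext
  have hπu : (((Gp L H).rightRegular μ).restrict (archToAdelic (↥(maximalRealSubfield L)) L (IsCMField.complexConj L) 3 H)).IsUnitary :=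
    ((Gp L H).isUnitary_rightRegular μ).restrict _
  rw [coe_descend_apply W hσ, ContinuousLinearMap.comp_apply, ContinuousLinearMap.comp_apply]
  change ((W.toSubmodule.orthogonalProjectionOnto (((P.archRepCM ι T hT u v : P.space.toSubmodule) : (Gp L H).L2 μ)) : W.toSubmodule) : (Gp L H).L2 μ) =
    (Gp L H).rightRegular μ (cmArchSectionUForm L ι H T hT u) ((W.toSubmodule.orthogonalProjectionOnto (v : (Gp L H).L2 μ) : W.toSubmodule) : (Gp L H).L2 μ)
  rw [DiscreteAutomorphicRep.coe_archRep_apply, Submodule.coe_orthogonalProjectionOnto_apply, Submodule.coe_orthogonalProjectionOnto_apply,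
    ← archToAdelic_archLift L ι H T hT u]
  exact W.starProjection_map_apply hπu (archLift L ι H T hT u) (v : (Gp L H).L2 μ)

include hσ hW in
/-- **The inclusion `W ↪ P.space` intertwines `σbar` with `P.archRepCM`** (same identity read on `W`). [cite: BorelJacquetCorvallis1979, §4.3 and §4.6] -/
theorem inclusion_intertwines (u : (uFormGroup (Fin 2) (Fin 1)).carrier) (w : W.toSubmodule) :
    (⟨Submodule.inclusion hW, continuous_inclusion hW⟩ : W.toSubmodule →L[ℂ] P.space.toSubmodule) (σbar u w) =
      P.archRepCM ι T hT u ((⟨Submodule.inclusion hW, continuous_inclusion hW⟩ : W.toSubmodule →L[ℂ] P.space.toSubmodule) w) := by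
  apply Subtype.ext
  change ((σbar u w : W.toSubmodule) : (Gp L H).L2 μ) = ((P.archRepCM ι T hT u ⟨(w : (Gp L H).L2 μ), hW w.2⟩ : P.space.toSubmodule) : (Gp L H).L2 μ)
  rw [coe_descend_apply W hσ, DiscreteAutomorphicRep.coe_archRep_apply]

-- nested subtype carriers `H_K^∞(σbar) ⊆ W ⊆ L²` and `archModuleCM ⊆ P.space ⊆ L²`: `isDefEq` through the coercion layers (the `HasOrthogonalProjection` ∕
-- `CompleteSpace ↥W` instance path and `archModuleCM = harishChandraSpace _`) times out at the default 200k (measured); passes at 1.6M in < 30 s wall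
set_option maxHeartbeats 1600000 in
include hσ hW in
/-- **THE TOKEN**: for a closed `G′_∞`-block `W ≤ P.space` with descent `σbar` whose Harish-Chandra module is non-zero, the orthogonal projection induces a NON-ZERO
`(𝔤, K)`-map `P.archModuleCM → H_K^∞(σbar)` (★ `Intertwiner.harishChandraMap`, `…_repK`, `…_repLie`; non-zero because it restricts to the identity on the image of
`H_K^∞(σbar)` under the inclusion) — `HasToken P (H_K^∞(σbar))`. [cite: FlathCorvallis1979, Thm. 3 and Thm. 4] [cite: BorelJacquetCorvallis1979, §4.6]
[cite: Rogawski1990, §14.5 p. 237] -/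
theorem hasToken_harishChandra_of_closedSubrep (hc : σbar.IsStronglyContinuous)
    [Nontrivial (harishChandraSpace (uFormGroup (Fin 2) (Fin 1)) σbar)] :
    HasToken L H ι T hT μ P (harishChandraSpace (uFormGroup (Fin 2) (Fin 1)) σbar) (harishChandraRepK (uFormGroup (Fin 2) (Fin 1)) σbar)
      (harishChandraRepLie (uFormGroup (Fin 2) (Fin 1)) σbar hc) := by
  -- the two bounded intertwiners
  have hT₀ := orthogonalProjection_intertwines (ι := ι) (T := T) (hT := hT) P W hσ
  have hi := inclusion_intertwines (ι := ι) (T := T) (hT := hT) P W hW hσ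
  have hPc : (P.archRepCM ι T hT).IsStronglyContinuous :=
    P.isStronglyContinuous_archRep (uFormGroup (Fin 2) (Fin 1)) (cmArchSectionUForm L ι H T hT) (continuous_cmArchSectionUForm L ι H T hT)
  refine ⟨Intertwiner.harishChandraMap (uFormGroup (Fin 2) (Fin 1)) hT₀, fun k w => ?_, fun X w => ?_, ?_⟩
  · exact Intertwiner.harishChandraMap_repK (uFormGroup (Fin 2) (Fin 1)) hT₀ k w
  · exact Intertwiner.harishChandraMap_repLie (uFormGroup (Fin 2) (Fin 1)) hT₀ hPc hc X w
  · -- non-zero: `p_W ∘ incl = id` on `H_K^∞(σbar)`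
    obtain ⟨w, hw⟩ := exists_ne (0 : harishChandraSpace (uFormGroup (Fin 2) (Fin 1)) σbar)
    intro h0
    have h1 : Intertwiner.harishChandraMap (uFormGroup (Fin 2) (Fin 1)) hT₀ (Intertwiner.harishChandraMap (uFormGroup (Fin 2) (Fin 1)) hi w) = 0 := by
      rw [h0]; rfl
    have h2 : (Intertwiner.harishChandraMap (uFormGroup (Fin 2) (Fin 1)) hT₀ (Intertwiner.harishChandraMap (uFormGroup (Fin 2) (Fin 1)) hi w) :
        W.toSubmodule) = (w : W.toSubmodule) := by
      have h3 : W.toSubmodule.orthogonalProjectionOnto (((w : W.toSubmodule)) : (Gp L H).L2 μ) = (w : W.toSubmodule) :=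
        Submodule.orthogonalProjectionOnto_mem_subspace_eq_self (w : W.toSubmodule)
      rw [Intertwiner.coe_harishChandraMap_apply, Intertwiner.coe_harishChandraMap_apply, ContinuousLinearMap.comp_apply, Submodule.subtypeL_apply]
      exact h3
    rw [h1, Submodule.coe_zero] at h2
    exact hw (Subtype.ext h2.symm)

end Token

/-! ## §4 L-iso from F1a for admissible blocks -/

section Main

variable {μ : Measure (Gp L H).automorphicQuotient} [(Gp L H).IsAutomorphicMeasure μ]

-- `clInfChoiceU_eq_ofModule`'s token binder unifies `archModuleCM`∕`archRepKCM`∕`archRepLieCM` with the `harishChandra*` spellings through two subtype layers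
-- (`isDefEq` time-out at the default 200k, measured; passes at 400k)
set_option maxHeartbeats 400000 in
/-- **THE CLASS OF AN ADMISSIBLE ARCHIMEDEAN BLOCK IS THE TOKEN OF RECORD.**  Let `P` be a discrete automorphic representation of `U(H)(𝔸)` satisfying F1a (★
`ArchIsotypy`) at the CM frame, `W ≤ P.space` a closed topologically irreducible `G′_∞`-invariant subspace with a descent `σbar` along `archProjUForm`, and assume the
Harish-Chandra module of `σbar` is `K∞`-admissible.  Then `σbar` is a unitary globalization of `clInfChoiceU … dflt P`.
PROOF: `σbar` is unitary and strongly continuous (★ p838350), topologically irreducible (§1); by FILE A (★ `isIrreducibleGK_harishChandra_of_isAdmissibleGK`, `U(2,1)`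
exp-generated ★ `subgroup_eq_top_of_forall_expMem_mem_uForm`) its Harish-Chandra module `M` is irreducible, and it is admissible, a `(𝔤, K)`-module (★
`isGKModule_harishChandra_holds`) and unitary along `𝔭 ⊕ ℝz₀` (★ `isInfUnitary_harishChandra` + ★ T3a₄) — a COH-UNITARY token target of `P` (§3); F1a pins
`clInfChoiceU dflt P = [M]` (★ `clInfChoiceU_eq_ofModule`), and `σbar` globalizes `[M]` tautologically.
[cite: HarishChandra1953, §9 Thms. 4–6 and Thm. 8] [cite: FlathCorvallis1979, Thm. 3 and Thm. 4] [cite: Dixmier1977, §13.1.8] [cite: Rogawski1990, §14.5 p. 237] -/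
theorem isUnitaryGlobalization_clInfChoiceU_of_archIsotypy (dflt : Cinf) (P : DiscreteAutomorphicRep (Gp L H) μ)
    (hF1a : P.ArchIsotypy (uFormGroup (Fin 2) (Fin 1)) (cmArchSectionUForm L ι H T hT))
    (W : ClosedSubrep (((Gp L H).rightRegular μ).restrict (archToAdelic (↥(maximalRealSubfield L)) L (IsCMField.complexConj L) 3 H)))
    (hW : W.toSubmodule ≤ P.space.toSubmodule) (hirr : W.toContRep.IsTopIrreducible)
    (σbar : ContRepresentation ℂ (uFormGroup (Fin 2) (Fin 1)).carrier W.toSubmodule) (hσ : ∀ g, W.toContRep g = σbar (archProjUForm L ι H T hT g))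
    (hadm : IsAdmissibleGK (harishChandraRepK (uFormGroup (Fin 2) (Fin 1)) σbar)) :
    IsUnitaryGlobalization (uFormGroup (Fin 2) (Fin 1)) (clInfChoiceU L H ι T hT μ dflt P) σbar := by
  -- unitarity ∕ strong continuity ∕ irreducibility of the descent
  have hπu : (((Gp L H).rightRegular μ).restrict (archToAdelic (↥(maximalRealSubfield L)) L (IsCMField.complexConj L) 3 H)).IsUnitary :=
    ((Gp L H).isUnitary_rightRegular μ).restrict _
  have hπc : (((Gp L H).rightRegular μ).restrict (archToAdelic (↥(maximalRealSubfield L)) L (IsCMField.complexConj L) 3 H)).IsStronglyContinuous :=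
    ((Gp L H).isStronglyContinuous_rightRegular_holds μ).restrict _ (continuous_archToAdelic (↥(maximalRealSubfield L)) L (IsCMField.complexConj L) 3 H)
  have hWu : W.toContRep.IsUnitary := hπu.toContRep W
  have hWc : W.toContRep.IsStronglyContinuous := fun v => by
    have h1 : Continuous fun g => ((W.toContRep g v : W.toSubmodule) : (Gp L H).L2 μ) := by
      simp only [ClosedSubrep.coe_toContRep_apply]
      exact hπc (v : (Gp L H).L2 μ)
    exact continuous_induced_rng.2 h1
  have hu : σbar.IsUnitary := isUnitary_of_descend L ι H T hT hσ hWu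
  have hc : σbar.IsStronglyContinuous := isStronglyContinuous_of_descend L ι H T hT hσ hWc
  have hirrσ : σbar.IsTopIrreducible := isTopIrreducible_of_descend L ι H T hT hσ hirr
  -- FILE A: the Harish-Chandra module of `σbar` is irreducible (and it is admissible, `(𝔤, K)`, infinitesimally unitary)
  have hirrM := isIrreducibleGK_harishChandra_of_isAdmissibleGK hu hc hirrσ subgroup_eq_top_of_forall_expMem_mem_uForm hadm
  have hM : IsGKModule (uFormGroup (Fin 2) (Fin 1)) (harishChandraRepK (uFormGroup (Fin 2) (Fin 1)) σbar) (harishChandraRepLie (uFormGroup (Fin 2) (Fin 1)) σbar hc) :=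
    isGKModule_harishChandra_holds (uFormGroup (Fin 2) (Fin 1)) σbar hc _ (fun _ _ => rfl)
      (isHarishChandraModuleOf_harishChandraRepLie (uFormGroup (Fin 2) (Fin 1)) σbar hc)
  have hinf : Liu2021.LemD2.IsInfUnitary (harishChandraRepK (uFormGroup (Fin 2) (Fin 1)) σbar) (harishChandraRepLie (uFormGroup (Fin 2) (Fin 1)) σbar hc) :=
    isInfUnitary_harishChandra hu hc
  obtain ⟨B, hB1, hB2, hB3, -⟩ := hinf
  have hunit : IsUnitaryAlongP (harishChandraRepLie (uFormGroup (Fin 2) (Fin 1)) σbar hc) :=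
    stubT3aUnitaryAlongPOfHermitian_holds (Fin 2) (Fin 1) (harishChandraSpace (uFormGroup (Fin 2) (Fin 1)) σbar)
      (harishChandraRepLie (uFormGroup (Fin 2) (Fin 1)) σbar hc) ⟨B, hB1, hB2, hB3⟩
  have hcoh : IsCohUnitaryIrrep (harishChandraRepK (uFormGroup (Fin 2) (Fin 1)) σbar) (harishChandraRepLie (uFormGroup (Fin 2) (Fin 1)) σbar hc) :=
    ⟨hM, hirrM, hadm, hunit⟩
  -- the token and the pin
  haveI := hirrM.nontrivial
  have htok := hasToken_harishChandra_of_closedSubrep (ι := ι) (T := T) (hT := hT) P W hW hσ hc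
  have hpin := clInfChoiceU_eq_ofModule L H ι T hT μ dflt P hF1a
    ⟨⟨harishChandraSpace (uFormGroup (Fin 2) (Fin 1)) σbar, harishChandraRepK (uFormGroup (Fin 2) (Fin 1)) σbar,
      harishChandraRepLie (uFormGroup (Fin 2) (Fin 1)) σbar hc, hM, hirrM⟩, htok, hcoh⟩ hM hirrM htok
  rw [hpin, GKIrrClass.ofModule_eq_mk]
  exact ⟨hu, hc, _, rfl, AreGKEquivalent.refl _ _⟩

/-- **L-iso ⟸ F1a FOR ADMISSIBLE BLOCKS** — the `hiso` binder of ★ p839537 `h3_of_core_of_adm_of_iso` at the class `c` (without its unused `cptTriv₀ c` antecedent),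
GIVEN F1a for `rep c` BY NAME and `K∞`-admissibility of the block's Harish-Chandra module: every closed topologically irreducible `G′_∞`-block `W ≤ rep c` is, under any
descent `σbar` along `archProjUForm`, a unitary globalization of `clInfChoiceU … (rep c)`. [cite: Dixmier1977, §13.1.8] [cite: FlathCorvallis1979, Thm. 3 and Thm. 4]
[cite: HarishChandra1953, §9 Thms. 4–6 and Thm. 8] -/
theorem liso_of_archIsotypy_of_isAdmissibleGK (dflt : Cinf) (c : Cls (Gp L H) μ)
    (hF1a : (rep (Gp L H) μ c).ArchIsotypy (uFormGroup (Fin 2) (Fin 1)) (cmArchSectionUForm L ι H T hT))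
    (W : ClosedSubrep (((Gp L H).rightRegular μ).restrict (archToAdelic (↥(maximalRealSubfield L)) L (IsCMField.complexConj L) 3 H)))
    (hW : W.toSubmodule ≤ (rep (Gp L H) μ c).space.toSubmodule) (hirr : W.toContRep.IsTopIrreducible)
    (σbar : ContRepresentation ℂ (uFormGroup (Fin 2) (Fin 1)).carrier W.toSubmodule) (hσ : ∀ g, W.toContRep g = σbar (archProjUForm L ι H T hT g))
    (hadm : IsAdmissibleGK (harishChandraRepK (uFormGroup (Fin 2) (Fin 1)) σbar)) :
    IsUnitaryGlobalization (uFormGroup (Fin 2) (Fin 1)) (clInfChoiceU L H ι T hT μ dflt (rep (Gp L H) μ c)) σbar :=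
  isUnitaryGlobalization_clInfChoiceU_of_archIsotypy L ι H T hT dflt (rep (Gp L H) μ c) hF1a W hW hirr σbar hσ hadm

end Main

end Summit.HodgeConjecture.HodgeConjecture.Cruxes.H413.F0P3ArchBlockClassOfArchIsotypy

end
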